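import Summits.ValiantsHypothesis.ValiantsHypothesis.Theorems.LacunarySymmetroidMatrixDescartesCensusDoorA34RankTwoNet

/-!
# `MatrixDescartes` census — DOOR A at `(3,4)`: the REDUCIBLE CONE stratum (dependent letters, reducible plane cubic), ALL supports

HONEST FRAMING.  Object-search cell `pub-symmetroid`, door-A seat `val-sym-door-p3` (g23); a PARTIAL-RANGE row `--supports` the
route item `Theses.LacunarySymmetroid.DoorA34` (stmt-ValiantsHypothesis-19980, `DoorA34 = PosRootLawAt 3 4 18`), OPEN and asserted
nowhere here.  Companion of `…CensusDoorA34RankTwoNet` (letter span of dimension `≤ 2`: `≤ 9`).  The next degenerate stratum is the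
CONE stratum: the four letters span a THREE-dimensional space of matrices, `S_l = ∑ᵢ c_{il}·Tᵢ` (`i < 3`), so that the determinant of the
pencil is the plane cubic `C(y) = det(∑ᵢ yᵢTᵢ)` composed with the planar `4`-nomial curve `(A₀,A₁,A₂)`, `Aᵢ = ∑ₗ c_{il} X^{d_l}` (a cone
over `C` cut by the moment arc).  This file bounds the REDUCIBLE cones for every support:

* `sum_smul_rankThreeNet` / `eval_det_pencil_rankThreeNet` — the pencil evaluates at `t` to `det(∑ᵢ Aᵢ(t)·Tᵢ) = C(A₀(t),A₁(t),A₂(t))`;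
* **`card_posRoots_le_twelve_of_reducibleCone`** — if `C(y) = ℓ(y)·q(y)` with `ℓ` linear and `q` quadratic (line × conic, or three lines),
  the pencil has at most `3 + 9 = 12` distinct positive det-roots: `ℓ(A)` is a `4`-nomial (`≤ 3`, `Census.card_posRoots_borderNomial_le`)
  and `q(A)` is supported on the `≤ 10` pair sums `d_l + d_{l'}` (`≤ 9`); `doorA34_ineq_on_reducibleCone` — hence `≤ 18` there.

The IRREDUCIBLE cones (C an irreducible real plane cubic; every real plane cubic is a real symmetroid, so all of them occur) are NOT
bounded here; they are the family «plane cubic ∘ planar 4-nomial curve» located at `13–14` by the seat's kit job j322796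
(`DOOR-A34-P3G23-REPORT` §2), Descartes ceiling `19`.  Nothing here bounds `ζ_sym(3,4)` beyond the reducible cones; `DoorA34` and
`MatrixDescartes` (stmt-ValiantsHypothesis-18050) stay OPEN; nothing bears on `VP ≠ VNP`.  [folklore] Elementary; sparse Descartes rule.
-/

-- `Summit.ValiantsHypothesis.ValiantsHypothesis.…` repeats a component by the D-0017 layout
-- (single-conjunct summit), which the `dupNamespace` linter flags; the name is mandated.
set_option linter.dupNamespace false

namespace Summit.ValiantsHypothesis.ValiantsHypothesis.Theorems.LacunarySymmetroidMatrixDescartes.Census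

open Polynomial Finset
open scoped BigOperators Polynomial Matrix
open Summit.ValiantsHypothesis.ValiantsHypothesis.Theorems.MatrixDescartes.Negative (PosRootLawAt)
open Summit.ValiantsHypothesis.ValiantsHypothesis.Theorems.SymmetroidDescartes (eval_det_pencil)

namespace ReducibleCone

/-- The letters of a rank-three net evaluate to `∑ᵢ Aᵢ(t)·Tᵢ`. [folklore] -/
theorem sum_smul_rankThreeNet {K : ℕ} (d : Fin K → ℕ) (T : Fin 3 → Matrix (Fin 3) (Fin 3) ℝ) (c : Fin 3 → Fin K → ℝ) (t : ℝ) :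
    (∑ l, t ^ d l • ∑ i, c i l • T i) = ∑ i, (∑ l, c i l * t ^ d l) • T i := by
  simp only [Finset.smul_sum, smul_smul, Finset.sum_smul]
  rw [Finset.sum_comm]
  exact Finset.sum_congr rfl fun i _ => Finset.sum_congr rfl fun l _ => by rw [mul_comm]

/-- **Evaluation of the determinant of a rank-three net**: `det(∑ₗ t^{d_l} S_l) = det(∑ᵢ Aᵢ(t)·Tᵢ)`, `Aᵢ(t) = ∑ₗ c_{il} t^{d_l}`. [folklore] -/
theorem eval_det_pencil_rankThreeNet {K : ℕ} (d : Fin K → ℕ) (T : Fin 3 → Matrix (Fin 3) (Fin 3) ℝ) (c : Fin 3 → Fin K → ℝ) (t : ℝ) :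
    ((∑ l, (X : ℝ[X]) ^ d l • (∑ i, c i l • T i).map C).det).eval t
      = (∑ i, (∑ l, c i l * t ^ d l) • T i).det := by
  rw [eval_det_pencil, sum_smul_rankThreeNet]

/-- A polynomial `∑_{p : Fin 4 × Fin 4} C(k_p)·X^{d_{p.1} + d_{p.2}}` is supported on the pair sums of `d`, of which there are at most `10`
(the image of the pairs `p.1 ≤ p.2`). [folklore] -/
theorem card_support_pairNomial_le (d : Fin 4 → ℕ) (k : Fin 4 × Fin 4 → ℝ) :
    (∑ p : Fin 4 × Fin 4, C (k p) * (X : ℝ[X]) ^ (d p.1 + d p.2)).support.card ≤ 10 := by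
  classical
  set Img := ((Finset.univ : Finset (Fin 4 × Fin 4)).filter (fun p => p.1 ≤ p.2)).image (fun p => d p.1 + d p.2) with hImg
  have hsub : (∑ p : Fin 4 × Fin 4, C (k p) * (X : ℝ[X]) ^ (d p.1 + d p.2)).support ⊆ Img := by
    intro n hn
    rw [Polynomial.mem_support_iff, Polynomial.finsetSum_coeff] at hn
    by_contra hnot
    apply hn
    refine Finset.sum_eq_zero fun p _ => ?_
    rw [Polynomial.coeff_C_mul, Polynomial.coeff_X_pow]
    have : n ≠ d p.1 + d p.2 := by
      intro h
      apply hnot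
      rw [hImg, Finset.mem_image]
      rcases le_total p.1 p.2 with hle | hle
      · exact ⟨(p.1, p.2), Finset.mem_filter.mpr ⟨Finset.mem_univ _, hle⟩, h.symm⟩
      · exact ⟨(p.2, p.1), Finset.mem_filter.mpr ⟨Finset.mem_univ _, hle⟩, by rw [h]; exact add_comm _ _⟩
    simp [this]
  have hdom : ((Finset.univ : Finset (Fin 4 × Fin 4)).filter (fun p => p.1 ≤ p.2)).card = 10 := by decide
  calc (∑ p : Fin 4 × Fin 4, C (k p) * (X : ℝ[X]) ^ (d p.1 + d p.2)).support.card ≤ Img.card := Finset.card_le_card hsub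
    _ ≤ ((Finset.univ : Finset (Fin 4 × Fin 4)).filter (fun p => p.1 ≤ p.2)).card := Finset.card_image_le
    _ = 10 := hdom

/-- A non-zero pair-nomial (supported on the pair sums of a `4`-support) has at most `9` distinct positive roots. [folklore] -/
theorem card_posRoots_pairNomial_le (d : Fin 4 → ℕ) (k : Fin 4 × Fin 4 → ℝ)
    (hk : (∑ p : Fin 4 × Fin 4, C (k p) * (X : ℝ[X]) ^ (d p.1 + d p.2)) ≠ 0) :
    ((∑ p : Fin 4 × Fin 4, C (k p) * (X : ℝ[X]) ^ (d p.1 + d p.2)).roots.toFinset.filter (fun t => 0 < t)).card ≤ 9 := by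
  have h1 := Literature.Computability.AlgebraicComplexity.card_roots_toFinset_filter_pos_lt_card_support hk
  have h2 := card_support_pairNomial_le d k
  omega

/-- The pair-nomial of a quadratic form `q` on the node `4`-nomials evaluates to `q(A(t))`. [folklore] -/
theorem eval_pairNomial_quadratic (d : Fin 4 → ℕ) (q : Fin 3 → Fin 3 → ℝ) (c : Fin 3 → Fin 4 → ℝ) (t : ℝ) :
    (∑ p : Fin 4 × Fin 4, C (∑ i, ∑ j, q i j * c i p.1 * c j p.2) * (X : ℝ[X]) ^ (d p.1 + d p.2)).eval t
      = ∑ i, ∑ j, q i j * (∑ l, c i l * t ^ d l) * (∑ l, c j l * t ^ d l) := by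
  rw [eval_finsetSum]
  simp only [eval_mul, eval_C, eval_pow, eval_X, Fintype.sum_prod_type, Fin.sum_univ_three, Fin.sum_univ_four, pow_add]
  ring

/-- **THE REDUCIBLE CONE COUNT (all supports).**  If the four letters of a `(3,4)` pencil lie in the span of three real `3 × 3` matrices
`T₀,T₁,T₂`, `S_l = ∑ᵢ c_{il}·Tᵢ`, and the plane cubic `C(y) = det(∑ᵢ yᵢTᵢ)` FACTORS over `ℝ` as a linear form times a quadratic form,
`C(y) = (∑ᵢ ℓᵢyᵢ)·(∑ᵢⱼ qᵢⱼ yᵢyⱼ)`, then the pencil has at most `12` distinct positive det-roots.  (No symmetry of the letters is needed.)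
[folklore] -/
theorem card_posRoots_le_twelve_of_reducibleCone (d : Fin 4 → ℕ) (S : Fin 4 → Matrix (Fin 3) (Fin 3) ℝ)
    (T : Fin 3 → Matrix (Fin 3) (Fin 3) ℝ) (c : Fin 3 → Fin 4 → ℝ) (hS : ∀ l, S l = ∑ i, c i l • T i)
    (ℓ : Fin 3 → ℝ) (q : Fin 3 → Fin 3 → ℝ)
    (hfac : ∀ y : Fin 3 → ℝ, (∑ i, y i • T i).det = (∑ i, ℓ i * y i) * (∑ i, ∑ j, q i j * y i * y j)) :
    (((∑ l, (X : ℝ[X]) ^ d l • (S l).map C).det).roots.toFinset.filter (fun t => 0 < t)).card ≤ 12 := by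
  classical
  have hsum : (∑ l, (X : ℝ[X]) ^ d l • (S l).map C) = ∑ l, (X : ℝ[X]) ^ d l • (∑ i, c i l • T i).map C :=
    Finset.sum_congr rfl fun l _ => by rw [hS l]
  rw [hsum]
  set P : ℝ[X] := (∑ l, (X : ℝ[X]) ^ d l • (∑ i, c i l • T i).map C).det with hPdef
  -- the two factor polynomials
  set Lp : ℝ[X] := ∑ l, C (∑ i, ℓ i * c i l) * (X : ℝ[X]) ^ d l with hLp
  set Qp : ℝ[X] := ∑ p : Fin 4 × Fin 4, C (∑ i, ∑ j, q i j * c i p.1 * c j p.2) * (X : ℝ[X]) ^ (d p.1 + d p.2) with hQp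
  have hLeval : ∀ t : ℝ, Lp.eval t = ∑ i, ℓ i * (∑ l, c i l * t ^ d l) := fun t => by
    rw [hLp, eval_nodePoly]
    simp only [Fin.sum_univ_three, Fin.sum_univ_four]
    ring
  have hQeval : ∀ t : ℝ, Qp.eval t = ∑ i, ∑ j, q i j * (∑ l, c i l * t ^ d l) * (∑ l, c j l * t ^ d l) := fun t => by
    rw [hQp, eval_pairNomial_quadratic]
  have hevalP : ∀ t : ℝ, P.eval t = Lp.eval t * Qp.eval t := fun t => by
    rw [hPdef, eval_det_pencil_rankThreeNet, hfac, hLeval, hQeval]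
  by_cases hP : P = 0
  · rw [hP, Polynomial.roots_zero, Multiset.toFinset_zero, Finset.filter_empty, Finset.card_empty]
    exact Nat.zero_le _
  have hL0 : Lp ≠ 0 := by
    intro h; apply hP; apply RankTwoNet.eq_zero_of_forall_pos_isRoot; intro t _
    rw [Polynomial.IsRoot.def, hevalP, h, eval_zero, zero_mul]
  have hQ0 : Qp ≠ 0 := by
    intro h; apply hP; apply RankTwoNet.eq_zero_of_forall_pos_isRoot; intro t _
    rw [Polynomial.IsRoot.def, hevalP, h, eval_zero, mul_zero]
  have hcover : (P.roots.toFinset.filter (fun t => 0 < t))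
      ⊆ (Lp.roots.toFinset.filter (fun t => 0 < t)) ∪ (Qp.roots.toFinset.filter (fun t => 0 < t)) := by
    intro t ht
    rw [Finset.mem_filter, Multiset.mem_toFinset, Polynomial.mem_roots hP, Polynomial.IsRoot.def, hevalP] at ht
    rw [Finset.mem_union, Finset.mem_filter, Finset.mem_filter, Multiset.mem_toFinset, Multiset.mem_toFinset,
      Polynomial.mem_roots hL0, Polynomial.mem_roots hQ0, Polynomial.IsRoot.def, Polynomial.IsRoot.def]
    rcases mul_eq_zero.mp ht.1 with h | h
    · exact Or.inl ⟨h, ht.2⟩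
    · exact Or.inr ⟨h, ht.2⟩
  have hLcard : (Lp.roots.toFinset.filter (fun t => 0 < t)).card ≤ 3 :=
    card_posRoots_borderNomial_le d (fun l => ∑ i, ℓ i * c i l) hL0
  have hQcard : (Qp.roots.toFinset.filter (fun t => 0 < t)).card ≤ 9 := card_posRoots_pairNomial_le d _ hQ0
  calc (P.roots.toFinset.filter (fun t => 0 < t)).card
      ≤ ((Lp.roots.toFinset.filter (fun t => 0 < t)) ∪ (Qp.roots.toFinset.filter (fun t => 0 < t))).card :=
        Finset.card_le_card hcover
    _ ≤ (Lp.roots.toFinset.filter (fun t => 0 < t)).card + (Qp.roots.toFinset.filter (fun t => 0 < t)).card :=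
        Finset.card_union_le _ _
    _ ≤ 12 := by omega

/-- Hence the door's `≤ 18` on the reducible cones, for every support `d`. [folklore] -/
theorem doorA34_ineq_on_reducibleCone (d : Fin 4 → ℕ) (S : Fin 4 → Matrix (Fin 3) (Fin 3) ℝ)
    (T : Fin 3 → Matrix (Fin 3) (Fin 3) ℝ) (c : Fin 3 → Fin 4 → ℝ) (hS : ∀ l, S l = ∑ i, c i l • T i)
    (ℓ : Fin 3 → ℝ) (q : Fin 3 → Fin 3 → ℝ)
    (hfac : ∀ y : Fin 3 → ℝ, (∑ i, y i • T i).det = (∑ i, ℓ i * y i) * (∑ i, ∑ j, q i j * y i * y j)) :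
    (((∑ l, (X : ℝ[X]) ^ d l • (S l).map C).det).roots.toFinset.filter (fun t => 0 < t)).card ≤ 18 :=
  (card_posRoots_le_twelve_of_reducibleCone d S T c hS ℓ q hfac).trans (by norm_num)

/-! ## Refutation currency on the cone stratum -/

/-- Letters drawn from a net of three SYMMETRIC matrices are symmetric. [folklore] -/
theorem isSymm_of_rankThreeNet (T : Fin 3 → Matrix (Fin 3) (Fin 3) ℝ) (hT : ∀ i, (T i).IsSymm) (c : Fin 3 → ℝ) :
    (∑ i, c i • T i).IsSymm := by
  unfold Matrix.IsSymm
  rw [Matrix.transpose_sum]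
  exact Finset.sum_congr rfl fun i _ => by rw [Matrix.transpose_smul, (hT i).eq]

/-- **CONE CURRENCY.**  A NINETEEN on the cone stratum refutes the door: if three real symmetric `3 × 3` matrices `T₀,T₁,T₂` and real
coefficients `c_{il}` give a dependent-letter pencil `∑ₗ X^{d_l}(∑ᵢ c_{il}Tᵢ)` with `≥ 19` distinct positive det-roots on some support `d`
(equivalently, `DOOR-A34-P3G23-REPORT` §2b: the plane cubic `det(∑ yᵢTᵢ)` composed with the planar `4`-nomial curve has `19` positive zeros),
then `DoorA34` fails.  The family is LINEAR in the cubic for fixed `c` (`Sym³` of a `3`-plane of `4`-nomials). [folklore] -/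
theorem not_doorA34_of_cone_nineteen (d : Fin 4 → ℕ) (T : Fin 3 → Matrix (Fin 3) (Fin 3) ℝ) (hT : ∀ i, (T i).IsSymm)
    (c : Fin 3 → Fin 4 → ℝ)
    (h19 : 19 ≤ (((∑ l, (X : ℝ[X]) ^ d l • (∑ i, c i l • T i).map C).det).roots.toFinset.filter (fun t => 0 < t)).card) :
    ¬ DoorA34 := by
  intro hdoor
  have h18 := hdoor d (fun l => ∑ i, c i l • T i) (fun l => isSymm_of_rankThreeNet T hT (fun i => c i l))
  exact absurd (h19.trans h18) (by norm_num)

end ReducibleCone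

end Summit.ValiantsHypothesis.ValiantsHypothesis.Theorems.LacunarySymmetroidMatrixDescartes.Census
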